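import Literature.AlgebraicGeometry.ShimuraVarieties.UnitaryAuxiliaryLatticeVectors
import Literature.NumberTheory.Adeles.LevelIdealConjugationBrick
import HarnessLib

/-!
# A split lattice `Λ₀ ⊕ Λ₀·Λ′_V ⊂ W₀ ⊕ V_M` adapted to a compact `K × L₀` (Deligne's auxiliary level, split form)

Deligne's auxiliary construction [cite: Deligne1979ShimuraVarieties, Prop. 2.3.10 (PDF p. 32)] embeds
`U(H)(𝔸_f) × T₀(M)(𝔸_f)` into `GSp(W₀ ⊕ V_M)` block-diagonally (★ `auxResW₀`, ★ `auxResV`); the level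
analysis of [cite: Deligne1971TravauxShimura, Prop. 1.15 p. 132] needs an integral symplectic frame adapted to a
lattice which is (i) stable under a given compact `K × L₀` and (ii) SPLIT with the transfer property «`t ≡ 1 (mod N)`
on the `W₀`-summand ⇒ `t ≡ 1 (mod N)` on the `V`-summand».  This file produces the two summands in coordinates:

* `Λ₀ = Γ₀⁻¹ℤ^{1×d} ⊂ W₀`, stable under `L₀` (★ `Adeles.exists_rat_conj_entries_mem_integralFiniteAdeles` applied
  to the compact `auxResW₀(L₀)`);
* `Λ′_V = Γ′⁻¹ℤ^{3×d} ⊂ V_M`, stable under `K × L₀` (the same theorem applied to `auxResV(K × L₀)`);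
* the PRODUCT LATTICE `Λ_V := Λ₀ · Λ′_V = Γ⁻¹ℤ^{3×d}` (spanned by the `c₀(m) · v`, `c₀(m)` the basis of `Λ₀`,
  `v ∈ Λ′_V`; a full lattice with a `ℤ`-basis by ★ `Adeles.nonempty_basis_of_sandwiched`), which is again
  `K × L₀`-stable (★ saturation brick `forall_mem_integral_conj_of_sum`, the multiplications `A_m` by `c₀(m)`
  commuting with the action) and has the transfer property (★ congruence brick `isCongOne_conj_one_add_of_sum`
  fed by ★ `resMatrix_sub_one_mul_latticeMul`): if `t − 1` maps `Λ̂₀` into `NΛ̂₀` then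
  `(t − 1)(c₀(m)·v) = ((t − 1)c₀(m))·v ∈ NΛ̂₀·Λ′_V ⊆ NΛ̂_V`.

Main statement: `exists_split_lattice`.  Topic `AlgebraicGeometry/ShimuraVarieties`; namespace
`Literature.AlgebraicGeometry.ShimuraVarieties.UnitaryCanonicalModel.Aux`.  Theorems only.
-/

set_option autoImplicit false

noncomputable section

open Matrix NumberField IsDedekindDomain
open scoped TensorProduct NumberField.AdeleRing

namespace Literature.AlgebraicGeometry.ShimuraVarieties.UnitaryCanonicalModel.Aux

open Literature.AlgebraicGeometry.ModuliOfAbelianVarieties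
open Literature.NumberTheory.Automorphic (integralFiniteAdeles)
open Literature.NumberTheory.Automorphic.UnitaryGroup
open Literature.NumberTheory.Adeles (exists_rat_conj_entries_mem_integralFiniteAdeles nonempty_basis_of_sandwiched
  exists_nat_forall_int_eq_mul forall_mem_integral_conj_of_sum isCongOne_conj_one_add_of_sum)

variable {L : Type} [Field L] [NumberField L] [IsCMField L] (M : Type) [Field M] [NumberField M] [IsCMField M]
  (j : L →+* M) (H : Matrix (Fin 3) (Fin 3) L)

/-- The conjugate `γ_𝔸 c γ_𝔸⁻¹` in `GL_n(𝔸_{ℚ,f})`, as a matrix, is `γ_𝔸 · c · (γ⁻¹)_𝔸` (unfolding).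
[cite: PlatonovRapinchuk1994, §8.1] -/
theorem coe_map_mul_mul_inv {n : Type} [Fintype n] [DecidableEq n] (γ : GL n ℚ) (c : GL n finAdeleQ) :
    ((Matrix.GeneralLinearGroup.map (algebraMap ℚ finAdeleQ) γ * c *
        (Matrix.GeneralLinearGroup.map (algebraMap ℚ finAdeleQ) γ)⁻¹ : GL n finAdeleQ) : Matrix n n finAdeleQ) =
      (γ : Matrix n n ℚ).map (algebraMap ℚ finAdeleQ) * (c : Matrix n n finAdeleQ) *
        ((γ⁻¹ : GL n ℚ) : Matrix n n ℚ).map (algebraMap ℚ finAdeleQ) := by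
  rw [Units.val_mul, Units.val_mul, ← map_inv]
  rfl

omit [IsCMField M] in
/-- An integral point of `Λ₀`: for the basis `c₀` of `Λ₀ = Γ₀⁻¹ℤ^{1×d}` and integers `z` with
`z = D₀ · Γ₀[1]_b`, `Σ_m z_m c₀(m) = D₀`. [cite: PlatonovRapinchuk1994, §8.1] -/
theorem sum_smul_latticeVec_eq_of_eq (Γ₀ : GL (Fin 1 × Fin (Module.finrank ℚ M)) ℚ) (D₀ : ℚ)
    (z : Fin 1 × Fin (Module.finrank ℚ M) → ℚ)
    (hz : ∀ m, z m = D₀ * ((Γ₀ : Matrix (Fin 1 × Fin (Module.finrank ℚ M)) (Fin 1 × Fin (Module.finrank ℚ M)) ℚ) *ᵥ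
      fun ι => (ratBasis M).repr 1 ι.2) m) :
    ∑ m, z m • latticeVec M Γ₀ m = algebraMap ℚ M D₀ := by
  classical
  have hzv : z = D₀ • ((Γ₀ : Matrix (Fin 1 × Fin (Module.finrank ℚ M)) (Fin 1 × Fin (Module.finrank ℚ M)) ℚ) *ᵥ
      fun ι => (ratBasis M).repr 1 ι.2) := funext fun m => by rw [hz m, Pi.smul_apply, smul_eq_mul]
  have hG : ((Γ₀⁻¹ : GL (Fin 1 × Fin (Module.finrank ℚ M)) ℚ) :
      Matrix (Fin 1 × Fin (Module.finrank ℚ M)) (Fin 1 × Fin (Module.finrank ℚ M)) ℚ) *ᵥ z =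
      D₀ • fun ι => (ratBasis M).repr 1 ι.2 := by
    rw [hzv, Matrix.mulVec_smul, Matrix.mulVec_mulVec, ← Units.val_mul, inv_mul_cancel, Units.val_one,
      Matrix.one_mulVec]
  calc ∑ m, z m • latticeVec M Γ₀ m
      = ∑ ι : Fin 1 × Fin (Module.finrank ℚ M), (((Γ₀⁻¹ : GL (Fin 1 × Fin (Module.finrank ℚ M)) ℚ) :
          Matrix (Fin 1 × Fin (Module.finrank ℚ M)) (Fin 1 × Fin (Module.finrank ℚ M)) ℚ) *ᵥ z) ι • ratBasis M ι.2 := by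
        simp_rw [latticeVec, Finset.smul_sum, smul_smul]
        rw [Finset.sum_comm]
        refine Finset.sum_congr rfl fun ι _ => ?_
        rw [← Finset.sum_smul]
        congr 1
        simp only [Matrix.mulVec, dotProduct]
        exact Finset.sum_congr rfl fun m _ => mul_comm _ _
    _ = D₀ • ∑ ι : Fin 1 × Fin (Module.finrank ℚ M), (ratBasis M).repr 1 ι.2 • ratBasis M ι.2 := by
        rw [hG, Finset.smul_sum]
        refine Finset.sum_congr rfl fun ι _ => ?_
        rw [Pi.smul_apply, smul_eq_mul, mul_smul]
    _ = algebraMap ℚ M D₀ := by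
        simp only [Fintype.sum_prod_type, Finset.univ_unique, Finset.sum_singleton]
        rw [(ratBasis M).sum_repr, Algebra.algebraMap_eq_smul_one]

/-- **Split lattice adapted to a compact `K × L₀`.**  For compact subgroups `K ≤ U(H)(𝔸_f)`, `L₀ ≤ T₀(M)(𝔸_f)`
there are `Γ₀ ∈ GL_{1×d}(ℚ)` and `Γ ∈ GL_{3×d}(ℚ)` (bases of lattices `Λ₀ ⊂ W₀`, `Λ_V ⊂ V_M`) such that
(i) `Γ₀ · auxResW₀(t) · Γ₀⁻¹` is `ℤ̂`-integral for `t ∈ L₀` and `Γ · auxResV(p) · Γ⁻¹` is `ℤ̂`-integral for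
`p ∈ K × L₀` (stability), and (ii) for every `N` and every torus element `t`,
`Γ₀ · auxResW₀(t) · Γ₀⁻¹ ≡ 1 (mod N)` implies `Γ · auxResV(1, t) · Γ⁻¹ ≡ 1 (mod N)` (transfer of congruences from
the `W₀`-summand to the `V`-summand — the product-level property of Deligne's auxiliary level).
[cite: Deligne1971TravauxShimura, Prop. 1.15 p. 132] [cite: Deligne1979ShimuraVarieties, Prop. 2.3.10 (PDF p. 32)]
[cite: PlatonovRapinchuk1994, §8.1] -/
theorem exists_split_lattice
    (K : Subgroup ↥(finAdelic (↥(maximalRealSubfield L)) L (IsCMField.complexConj L) 3 H))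
    (L₀ : Subgroup ↥(torusFinAdelic M))
    (hK : IsCompact (K : Set ↥(finAdelic (↥(maximalRealSubfield L)) L (IsCMField.complexConj L) 3 H)))
    (hL₀ : IsCompact (L₀ : Set ↥(torusFinAdelic M))) :
    ∃ (Γ₀ : GL (Fin 1 × Fin (Module.finrank ℚ M)) ℚ) (Γ : GL (Fin 3 × Fin (Module.finrank ℚ M)) ℚ),
      (∀ t ∈ L₀, ∀ i k,
        ((Γ₀ : Matrix (Fin 1 × Fin (Module.finrank ℚ M)) (Fin 1 × Fin (Module.finrank ℚ M)) ℚ).map (algebraMap ℚ finAdeleQ) *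
            ((auxResW₀ M t : GL (Fin 1 × Fin (Module.finrank ℚ M)) finAdeleQ) :
              Matrix (Fin 1 × Fin (Module.finrank ℚ M)) (Fin 1 × Fin (Module.finrank ℚ M)) finAdeleQ) *
            ((Γ₀⁻¹ : GL (Fin 1 × Fin (Module.finrank ℚ M)) ℚ) :
              Matrix (Fin 1 × Fin (Module.finrank ℚ M)) (Fin 1 × Fin (Module.finrank ℚ M)) ℚ).map (algebraMap ℚ finAdeleQ))
          i k ∈ integralFiniteAdeles ℚ) ∧
      (∀ p ∈ K.prod L₀, ∀ i k,
        ((Γ : Matrix (Fin 3 × Fin (Module.finrank ℚ M)) (Fin 3 × Fin (Module.finrank ℚ M)) ℚ).map (algebraMap ℚ finAdeleQ) *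
            ((auxResV M j H p : GL (Fin 3 × Fin (Module.finrank ℚ M)) finAdeleQ) :
              Matrix (Fin 3 × Fin (Module.finrank ℚ M)) (Fin 3 × Fin (Module.finrank ℚ M)) finAdeleQ) *
            ((Γ⁻¹ : GL (Fin 3 × Fin (Module.finrank ℚ M)) ℚ) :
              Matrix (Fin 3 × Fin (Module.finrank ℚ M)) (Fin 3 × Fin (Module.finrank ℚ M)) ℚ).map (algebraMap ℚ finAdeleQ))
          i k ∈ integralFiniteAdeles ℚ) ∧
      (∀ (Nn : ℕ) (t : ↥(torusFinAdelic M)),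
        IsCongOne Nn
          ((Γ₀ : Matrix (Fin 1 × Fin (Module.finrank ℚ M)) (Fin 1 × Fin (Module.finrank ℚ M)) ℚ).map (algebraMap ℚ finAdeleQ) *
            ((auxResW₀ M t : GL (Fin 1 × Fin (Module.finrank ℚ M)) finAdeleQ) :
              Matrix (Fin 1 × Fin (Module.finrank ℚ M)) (Fin 1 × Fin (Module.finrank ℚ M)) finAdeleQ) *
            ((Γ₀⁻¹ : GL (Fin 1 × Fin (Module.finrank ℚ M)) ℚ) :
              Matrix (Fin 1 × Fin (Module.finrank ℚ M)) (Fin 1 × Fin (Module.finrank ℚ M)) ℚ).map (algebraMap ℚ finAdeleQ)) →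
        IsCongOne Nn
          ((Γ : Matrix (Fin 3 × Fin (Module.finrank ℚ M)) (Fin 3 × Fin (Module.finrank ℚ M)) ℚ).map (algebraMap ℚ finAdeleQ) *
            ((auxResV M j H (1, t) : GL (Fin 3 × Fin (Module.finrank ℚ M)) finAdeleQ) :
              Matrix (Fin 3 × Fin (Module.finrank ℚ M)) (Fin 3 × Fin (Module.finrank ℚ M)) finAdeleQ) *
            ((Γ⁻¹ : GL (Fin 3 × Fin (Module.finrank ℚ M)) ℚ) :
              Matrix (Fin 3 × Fin (Module.finrank ℚ M)) (Fin 3 × Fin (Module.finrank ℚ M)) ℚ).map (algebraMap ℚ finAdeleQ))) := by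
  classical
  -- Step 1: the `W₀`-lattice from the compact image `auxResW₀(L₀)`
  obtain ⟨Γ₀, hΓ₀⟩ := exists_rat_conj_entries_mem_integralFiniteAdeles (L₀.map (auxResW₀ M)) (by
    rw [Subgroup.coe_map]; exact hL₀.image (continuous_auxResW₀ M))
  have hW : ∀ t ∈ L₀, ∀ i k,
      ((Γ₀ : Matrix (Fin 1 × Fin (Module.finrank ℚ M)) (Fin 1 × Fin (Module.finrank ℚ M)) ℚ).map (algebraMap ℚ finAdeleQ) *
          ((auxResW₀ M t : GL (Fin 1 × Fin (Module.finrank ℚ M)) finAdeleQ) :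
            Matrix (Fin 1 × Fin (Module.finrank ℚ M)) (Fin 1 × Fin (Module.finrank ℚ M)) finAdeleQ) *
          ((Γ₀⁻¹ : GL (Fin 1 × Fin (Module.finrank ℚ M)) ℚ) :
            Matrix (Fin 1 × Fin (Module.finrank ℚ M)) (Fin 1 × Fin (Module.finrank ℚ M)) ℚ).map (algebraMap ℚ finAdeleQ))
        i k ∈ integralFiniteAdeles ℚ := by
    intro t ht
    rw [← coe_map_mul_mul_inv]
    exact (hΓ₀ _ (Subgroup.mem_map_of_mem _ ht)).1
  -- Step 2: the `V`-lattice `Λ′_V` from the compact image `auxResV(K × L₀)`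
  obtain ⟨Γ', hΓ'⟩ := exists_rat_conj_entries_mem_integralFiniteAdeles ((K.prod L₀).map (auxResV M j H)) (by
    rw [Subgroup.coe_map, Subgroup.coe_prod]; exact (hK.prod hL₀).image (continuous_auxResV M j H))
  have hV' : ∀ p ∈ K.prod L₀, ∀ i k,
      ((Γ' : Matrix (Fin 3 × Fin (Module.finrank ℚ M)) (Fin 3 × Fin (Module.finrank ℚ M)) ℚ).map (algebraMap ℚ finAdeleQ) *
          ((auxResV M j H p : GL (Fin 3 × Fin (Module.finrank ℚ M)) finAdeleQ) :
            Matrix (Fin 3 × Fin (Module.finrank ℚ M)) (Fin 3 × Fin (Module.finrank ℚ M)) finAdeleQ) *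
          ((Γ'⁻¹ : GL (Fin 3 × Fin (Module.finrank ℚ M)) ℚ) :
            Matrix (Fin 3 × Fin (Module.finrank ℚ M)) (Fin 3 × Fin (Module.finrank ℚ M)) ℚ).map (algebraMap ℚ finAdeleQ))
        i k ∈ integralFiniteAdeles ℚ := by
    intro p hp
    rw [← coe_map_mul_mul_inv]
    exact (hΓ' _ (Subgroup.mem_map_of_mem _ hp)).1
  -- abbreviations: `A m` (multiplication by `c₀(m)` on `V`), `Γ′⁻¹`
  obtain ⟨A, hA⟩ : ∃ A : Fin 1 × Fin (Module.finrank ℚ M) →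
      Matrix (Fin 3 × Fin (Module.finrank ℚ M)) (Fin 3 × Fin (Module.finrank ℚ M)) ℚ, A = latticeMul M Γ₀ := ⟨_, rfl⟩
  obtain ⟨Gi, hGi⟩ : ∃ Gi : Matrix (Fin 3 × Fin (Module.finrank ℚ M)) (Fin 3 × Fin (Module.finrank ℚ M)) ℚ,
      Gi = ((Γ'⁻¹ : GL (Fin 3 × Fin (Module.finrank ℚ M)) ℚ) :
        Matrix (Fin 3 × Fin (Module.finrank ℚ M)) (Fin 3 × Fin (Module.finrank ℚ M)) ℚ) := ⟨_, rfl⟩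
  obtain ⟨Gp, hGp⟩ : ∃ Gp : Matrix (Fin 3 × Fin (Module.finrank ℚ M)) (Fin 3 × Fin (Module.finrank ℚ M)) ℚ,
      Gp = (Γ' : Matrix (Fin 3 × Fin (Module.finrank ℚ M)) (Fin 3 × Fin (Module.finrank ℚ M)) ℚ) := ⟨_, rfl⟩
  have hGiGp : Gi * Gp = 1 := by rw [hGi, hGp, ← Units.val_mul, inv_mul_cancel, Units.val_one]
  -- Step 3: denominators
  obtain ⟨D₁, hD₁, hz₁'⟩ := exists_nat_forall_int_eq_mul
    (fun x : (Fin 1 × Fin (Module.finrank ℚ M)) × (Fin 3 × Fin (Module.finrank ℚ M)) × (Fin 3 × Fin (Module.finrank ℚ M)) =>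
      (A x.1 * Gi) x.2.1 x.2.2)
  choose z₁ hz₁ using hz₁'
  obtain ⟨D₂, hD₂, hz₂'⟩ := exists_nat_forall_int_eq_mul
    (fun x : (Fin 3 × Fin (Module.finrank ℚ M)) × (Fin 3 × Fin (Module.finrank ℚ M)) => Gp x.1 x.2)
  choose z₂ hz₂ using hz₂'
  obtain ⟨D₀, hD₀, hz₀'⟩ := exists_nat_forall_int_eq_mul
    (fun m : Fin 1 × Fin (Module.finrank ℚ M) =>
      ((Γ₀ : Matrix (Fin 1 × Fin (Module.finrank ℚ M)) (Fin 1 × Fin (Module.finrank ℚ M)) ℚ) *ᵥ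
        fun ι => (ratBasis M).repr 1 ι.2) m)
  choose z₀ hz₀ using hz₀'
  -- `Σ_m z₀ m A_m = D₀ • 1`
  have hsumA : ∑ m, (z₀ m : ℚ) • A m =
      (D₀ : ℚ) • (1 : Matrix (Fin 3 × Fin (Module.finrank ℚ M)) (Fin 3 × Fin (Module.finrank ℚ M)) ℚ) := by
    rw [hA]
    exact sum_smul_latticeMul_eq M Γ₀ (sum_smul_latticeVec_eq_of_eq M Γ₀ (D₀ : ℚ) (fun m => (z₀ m : ℚ)) hz₀)
  have hsumAG : ∑ m, (z₀ m : ℚ) • (A m * Gi) = (D₀ : ℚ) • Gi := by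
    have h : ∑ m, (z₀ m : ℚ) • (A m * Gi) = (∑ m, (z₀ m : ℚ) • A m) * Gi := by
      rw [Matrix.sum_mul]
      exact Finset.sum_congr rfl fun m _ => (Matrix.smul_mul _ _ _).symm
    rw [h, hsumA, Matrix.smul_mul, Matrix.one_mul]
  -- Step 4: the product lattice `Λ = D₁ · Λ₀ · Λ′_V ⊆ ℤ^{3×d}` and its basis
  obtain ⟨g, hg⟩ : ∃ g : (Fin 1 × Fin (Module.finrank ℚ M)) × (Fin 3 × Fin (Module.finrank ℚ M)) →
      (Fin 3 × Fin (Module.finrank ℚ M)) → ℚ, g = fun mn i => (z₁ ⟨mn.1, i, mn.2⟩ : ℚ) := ⟨_, rfl⟩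
  have hgA : ∀ m n i, g (m, n) i = (D₁ : ℚ) * (A m * Gi) i n := fun m n i => by simp only [hg, hz₁]
  let Λ : Submodule ℤ ((Fin 3 × Fin (Module.finrank ℚ M)) → ℚ) := Submodule.span ℤ (Set.range g)
  have hint : ∀ q ∈ Λ, ∀ i, ∃ z : ℤ, (z : ℚ) = q i := by
    intro q hq
    induction hq using Submodule.span_induction with
    | mem x hx =>
        obtain ⟨mn, rfl⟩ := hx
        exact fun i => ⟨z₁ ⟨mn.1, i, mn.2⟩, by rw [hg]⟩
    | zero => exact fun i => ⟨0, by simp⟩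
    | add x y _ _ hx hy =>
        intro i
        obtain ⟨zx, hzx⟩ := hx i
        obtain ⟨zy, hzy⟩ := hy i
        exact ⟨zx + zy, by rw [Int.cast_add, hzx, hzy, Pi.add_apply]⟩
    | smul a x _ hx =>
        intro i
        obtain ⟨zx, hzx⟩ := hx i
        exact ⟨a * zx, by rw [Int.cast_mul, hzx, Pi.smul_apply, zsmul_eq_mul]⟩
  have hNbig : D₀ * D₁ * D₂ ≠ 0 := mul_ne_zero (mul_ne_zero hD₀ hD₁) hD₂
  have hstd : ∀ i, (((D₀ * D₁ * D₂ : ℕ) : ℚ) • Pi.single i 1 : (Fin 3 × Fin (Module.finrank ℚ M)) → ℚ) ∈ Λ := by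
    intro i
    -- `Σ_m z₀ m (A_m Γ′⁻¹)_{i′ n} = D₀ Γ′⁻¹_{i′ n}`
    have h1 : ∀ i' n : Fin 3 × Fin (Module.finrank ℚ M),
        ∑ m : Fin 1 × Fin (Module.finrank ℚ M), (z₀ m : ℚ) * (A m * Gi) i' n = (D₀ : ℚ) * Gi i' n := by
      intro i' n
      have h := congrFun (congrFun hsumAG i') n
      simp only [Matrix.sum_apply, Matrix.smul_apply, smul_eq_mul] at h
      exact h
    have hsum : (((D₀ * D₁ * D₂ : ℕ) : ℚ) • Pi.single i 1 : (Fin 3 × Fin (Module.finrank ℚ M)) → ℚ) =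
        ∑ mn : (Fin 1 × Fin (Module.finrank ℚ M)) × (Fin 3 × Fin (Module.finrank ℚ M)),
          (z₀ mn.1 * z₂ ⟨mn.2, i⟩) • g mn := by
      funext i'
      have e1 : ((((D₀ * D₁ * D₂ : ℕ) : ℚ) • Pi.single i 1 : (Fin 3 × Fin (Module.finrank ℚ M)) → ℚ)) i' =
          (D₁ : ℚ) * (D₂ : ℚ) * ((D₀ : ℚ) * (Gi * Gp) i' i) := by
        rw [hGiGp, Pi.smul_apply, smul_eq_mul, Nat.cast_mul, Nat.cast_mul, Matrix.one_apply, Pi.single_apply]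
        split_ifs <;> ring
      have e2 : ∀ mn : (Fin 1 × Fin (Module.finrank ℚ M)) × (Fin 3 × Fin (Module.finrank ℚ M)),
          ((z₀ mn.1 * z₂ ⟨mn.2, i⟩) • g mn) i' =
            (z₀ mn.1 : ℚ) * ((D₂ : ℚ) * Gp mn.2 i) * ((D₁ : ℚ) * (A mn.1 * Gi) i' mn.2) := by
        rintro ⟨m, n⟩
        rw [Pi.smul_apply, zsmul_eq_mul, hgA, Int.cast_mul, hz₂]
      have e3 : ∀ n : Fin 3 × Fin (Module.finrank ℚ M), ∑ m : Fin 1 × Fin (Module.finrank ℚ M),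
          (z₀ m : ℚ) * ((D₂ : ℚ) * Gp n i) * ((D₁ : ℚ) * (A m * Gi) i' n) =
            (∑ m : Fin 1 × Fin (Module.finrank ℚ M), (z₀ m : ℚ) * (A m * Gi) i' n) * ((D₁ : ℚ) * (D₂ : ℚ) * Gp n i) := by
        intro n
        rw [Finset.sum_mul]
        exact Finset.sum_congr rfl fun m _ => by ring
      have lhs : ((((D₀ * D₁ * D₂ : ℕ) : ℚ) • Pi.single i 1 : (Fin 3 × Fin (Module.finrank ℚ M)) → ℚ)) i' =
          ∑ n : Fin 3 × Fin (Module.finrank ℚ M), (D₁ : ℚ) * (D₂ : ℚ) * ((D₀ : ℚ) * Gi i' n * Gp n i) := by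
        rw [e1, Matrix.mul_apply, Finset.mul_sum, Finset.mul_sum]
        exact Finset.sum_congr rfl fun n _ => by ring
      have rhs : (∑ mn : (Fin 1 × Fin (Module.finrank ℚ M)) × (Fin 3 × Fin (Module.finrank ℚ M)),
            (z₀ mn.1 * z₂ ⟨mn.2, i⟩) • g mn) i' =
          ∑ n : Fin 3 × Fin (Module.finrank ℚ M), (D₁ : ℚ) * (D₂ : ℚ) * ((D₀ : ℚ) * Gi i' n * Gp n i) := by
        rw [Finset.sum_apply, Finset.sum_congr rfl fun mn _ => e2 mn, Fintype.sum_prod_type_right]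
        apply Finset.sum_congr rfl
        intro n _
        dsimp only
        rw [e3 n, h1 i' n]
        ring
      rw [lhs, rhs]
    rw [hsum]
    exact Submodule.sum_mem _ fun mn _ => Submodule.smul_mem _ _ (Submodule.subset_span ⟨mn, rfl⟩)
  obtain ⟨bΛ⟩ := nonempty_basis_of_sandwiched Λ hNbig hstd hint
  -- Step 5: the basis matrix `Γ⁻¹ = D₁⁻¹ · [bΛ]` and the integer relation matrices `B_m`, `D_m`
  have hmemb : ∀ n, ((bΛ n : Λ) : (Fin 3 × Fin (Module.finrank ℚ M)) → ℚ) ∈ Submodule.span ℤ (Set.range g) :=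
    fun n => (bΛ n).2
  choose cB hcB using fun n => (Submodule.mem_span_range_iff_exists_fun ℤ).1 (hmemb n)
  obtain ⟨Gm, hGm⟩ : ∃ Gm : Matrix (Fin 3 × Fin (Module.finrank ℚ M)) (Fin 3 × Fin (Module.finrank ℚ M)) ℚ,
      Gm = fun i n => (D₁ : ℚ)⁻¹ * ((bΛ n : Λ) : (Fin 3 × Fin (Module.finrank ℚ M)) → ℚ) i := ⟨_, rfl⟩
  obtain ⟨Bm, hBm⟩ : ∃ Bm : Fin 1 × Fin (Module.finrank ℚ M) →
      Matrix (Fin 3 × Fin (Module.finrank ℚ M)) (Fin 3 × Fin (Module.finrank ℚ M)) ℤ,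
      Bm = fun m n' n => cB n (m, n') := ⟨_, rfl⟩
  have hgmem : ∀ mn, g mn ∈ Λ := fun mn => Submodule.subset_span ⟨mn, rfl⟩
  obtain ⟨Dm, hDm⟩ : ∃ Dm : Fin 1 × Fin (Module.finrank ℚ M) →
      Matrix (Fin 3 × Fin (Module.finrank ℚ M)) (Fin 3 × Fin (Module.finrank ℚ M)) ℤ,
      Dm = fun m n n' => bΛ.repr ⟨g (m, n'), hgmem (m, n')⟩ n := ⟨_, rfl⟩
  have hD₁Q : (D₁ : ℚ) ≠ 0 := Nat.cast_ne_zero.2 hD₁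
  -- `g (m, n′) = Σ_n Dm m n n′ • bΛ n`
  have hgsum : ∀ m n' i, g (m, n') i =
      ∑ n, (Dm m n n' : ℚ) * ((bΛ n : Λ) : (Fin 3 × Fin (Module.finrank ℚ M)) → ℚ) i := by
    intro m n' i
    have h := congrArg (fun x : Λ => ((x : Λ) : (Fin 3 × Fin (Module.finrank ℚ M)) → ℚ) i)
      (bΛ.sum_repr ⟨g (m, n'), hgmem (m, n')⟩)
    simp only [AddSubmonoidClass.coe_finsetSum, Submodule.coe_smul, Finset.sum_apply, zsmul_eq_mul] at h
    rw [hDm]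
    exact h.symm
  have hDrel : ∀ m, A m * Gi = Gm * (Dm m).map (Int.cast : ℤ → ℚ) := by
    intro m
    ext i n'
    have h2 : (Gm * (Dm m).map (Int.cast : ℤ → ℚ)) i n' =
        ∑ n, (D₁ : ℚ)⁻¹ * ((bΛ n : Λ) : (Fin 3 × Fin (Module.finrank ℚ M)) → ℚ) i * (Dm m n n' : ℚ) := by
      rw [Matrix.mul_apply]
      simp only [hGm, Matrix.map_apply]
    rw [h2, ← mul_right_inj' hD₁Q, ← hgA m n' i, hgsum, Finset.mul_sum]
    exact Finset.sum_congr rfl fun n _ => by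
      rw [← mul_assoc, ← mul_assoc, mul_inv_cancel₀ hD₁Q, one_mul, mul_comm]
  have hBrel : Gm = ∑ m, A m * Gi * (Bm m).map (Int.cast : ℤ → ℚ) := by
    ext i n
    have h := congrFun (hcB n) i
    rw [Finset.sum_apply, Fintype.sum_prod_type] at h
    simp only [Pi.smul_apply, zsmul_eq_mul, hgA] at h
    rw [Matrix.sum_apply]
    simp only [hGm]
    rw [← h, Finset.mul_sum]
    refine Finset.sum_congr rfl fun m _ => ?_
    rw [Matrix.mul_apply, Finset.mul_sum]
    refine Finset.sum_congr rfl fun n' _ => ?_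
    simp only [hBm, Matrix.map_apply]
    rw [mul_left_comm ((cB n (m, n') : ℤ) : ℚ), ← mul_assoc, inv_mul_cancel₀ hD₁Q, one_mul, mul_comm]
  -- `Gm` is invertible: `Gm · (Σ_m z₀ m Dm m) · Γ′ = D₀`
  have hGinv : Gm * ((∑ m, (z₀ m : ℚ) • (Dm m).map (Int.cast : ℤ → ℚ)) * Gp * ((D₀ : ℚ)⁻¹ •
      (1 : Matrix (Fin 3 × Fin (Module.finrank ℚ M)) (Fin 3 × Fin (Module.finrank ℚ M)) ℚ))) = 1 := by
    have h : Gm * ∑ m, (z₀ m : ℚ) • (Dm m).map (Int.cast : ℤ → ℚ) = (D₀ : ℚ) • Gi := by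
      rw [← hsumAG, Matrix.mul_sum]
      exact Finset.sum_congr rfl fun m _ => by rw [Matrix.mul_smul, ← hDrel m]
    rw [← Matrix.mul_assoc, ← Matrix.mul_assoc, h, Matrix.smul_mul, hGiGp, Matrix.smul_mul, Matrix.one_mul,
      smul_smul, mul_inv_cancel₀ (Nat.cast_ne_zero.2 hD₀), one_smul]
  have hdet : Gm.det ≠ 0 := (Matrix.isUnit_det_of_right_inverse hGinv).ne_zero
  refine ⟨Γ₀, (Matrix.GeneralLinearGroup.mkOfDetNeZero Gm hdet)⁻¹, hW, ?_, ?_⟩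
  · -- (i) stability of `Λ_V` under `K × L₀`: saturation brick
    intro p hp
    have hΓinv : (((Matrix.GeneralLinearGroup.mkOfDetNeZero Gm hdet)⁻¹⁻¹ : GL (Fin 3 × Fin (Module.finrank ℚ M)) ℚ) :
        Matrix (Fin 3 × Fin (Module.finrank ℚ M)) (Fin 3 × Fin (Module.finrank ℚ M)) ℚ) = Gm := by
      rw [inv_inv]; rfl
    refine forall_mem_integral_conj_of_sum Γ' _ _ A Bm Dm (fun l => ?_) ?_ (fun l => ?_) (hV' p hp)
    · rw [hA]; exact latticeMul_map_mul_auxResV M Γ₀ j H l p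
    · rw [hΓinv, hBrel, hGi]
    · rw [hΓinv, ← hGi]; exact hDrel l
  · -- (ii) transfer of congruences `W₀ ⇒ V`: congruence brick
    intro Nn t hc
    have hΓinv : (((Matrix.GeneralLinearGroup.mkOfDetNeZero Gm hdet)⁻¹⁻¹ : GL (Fin 3 × Fin (Module.finrank ℚ M)) ℚ) :
        Matrix (Fin 3 × Fin (Module.finrank ℚ M)) (Fin 3 × Fin (Module.finrank ℚ M)) ℚ) = Gm := by
      rw [inv_inv]; rfl
    have hV1 : ((auxResV M j H (1, t) : GL (Fin 3 × Fin (Module.finrank ℚ M)) finAdeleQ) :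
          Matrix (Fin 3 × Fin (Module.finrank ℚ M)) (Fin 3 × Fin (Module.finrank ℚ M)) finAdeleQ) =
        1 + resMatrix (Algebra.TensorProduct.basis finAdeleQ (ratBasis M))
          (((torusToTensorFin M t : finAdeleQ ⊗[ℚ] M) - 1) • (1 : Matrix (Fin 3) (Fin 3) (finAdeleQ ⊗[ℚ] M))) := by
      rw [coe_auxResV_one_mk, ← map_one (resMatrix (Algebra.TensorProduct.basis finAdeleQ (ratBasis M))
        (m := Fin 3)), ← map_add, sub_smul, one_smul, add_sub_cancel]
    rw [hV1]
    refine isCongOne_conj_one_add_of_sum Γ' _ _ A Bm Dm _ hc (fun l => ?_) ?_ (fun l => ?_)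
    · rw [hA]; exact resMatrix_sub_one_mul_latticeMul t l
    · rw [hΓinv, hBrel, hGi]
    · rw [hΓinv, ← hGi]; exact hDrel l

end Literature.AlgebraicGeometry.ShimuraVarieties.UnitaryCanonicalModel.Aux

end
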